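import Summits.CriticalPhenomena.PercolationContinuityZ3.Theorems.PercNearOneGluingNoHeavyQuantLightTwoBlobFlow
import Summits.CriticalPhenomena.PercolationContinuityZ3.Theorems.PercNearOneGluingNoHeavyQuantTwoBlobTopFlippedHeavy
import HarnessLib

/-!
# QUANT lane R8, T-DEC: DEC of the two-blob law with TWO LOWS and a GIANT TOP from an explicit flow (typer g23's
# `twoBlob_decAtT_of_lowFlow` with the top above the layer) — the flow lemma behind the low-cross heavy-long piece

builds on p205010 (kernel theorem, internal audit signed; external expert review pending)

Support file (`--supports stmt-CriticalPhenomena-4575`), QUANT lane seat prim-quant-arm-2 (gen 31), rung R8 of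
`run/shared/lean/prim/quant/LADDER.md`.  One theorem, standard axioms, no sorries, no definitions.
* `LawDec.twoBlob_decAtT_of_twoLowFlow_top` — law `LAW2[p, u; q, v]` (atoms `0, p, q, p+q`), floor `0 < x < 1`, `1 ≤ p < q ≤ j″ < p + q`
  (the top a GIANT at layer `j″`), target `T` with `2p < T ≤ 2q` (atoms `0` and `p` low, `q` a mid); flows `p ↦ q` (amount `G`), `p ↦ p+q`
  (the rest of `u(1−v)`), `0 ↦ q` (amount `F`), `0 ↦ p+q` (the rest); if the mid is not overloaded (`usage(p,q)·G + usage(0,q)·F ≤ (1−u)v`)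
  and the giant is not overloaded (`(x/(1−x))·(u(1−v) − G + (1−u)(1−v) − F) ≤ uv`) then `DECAtT x T j″ (p+q) LAW2[p, u; q, v]`
  (via typer g22's `LawDec.decAtT_of_flowAtT`).

[this work]; DEC rules ARCH-TREES-G49 §2.2 / DEC-TAMP-G50 §3.1, the single-low criterion `…QuantSingleLowCapacity` (typer g23), the
cell-certificate pipeline FOR-PROVERS-CERT-PIPELINE (typer g23), the (II) piece anatomy FOR-PROVERS-CONV-PIECES (lead g26) — this lane.
Nothing here is cited as a published result.  The gluing rows served [cite: KozmaNitzan2024, Conjecture 3 (p. 15)]; product measure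
[cite: Grimmett1999, §1.3 p. 10].
-/

noncomputable section

namespace Summit.CriticalPhenomena.PercolationContinuityZ3.Theorems

namespace Quant

open Finset

/-- the two-blob law `(1−u)(1−v)δ₀ + u(1−v)δ_a + (1−u)vδ_b + uvδ_{a+b}` evaluated at `h` (as in `…QuantBlobDecTwoLawParts`) -/
local notation3 "LAW2[" a ", " u ", " b ", " v ", " h "]" =>
  (1 - (u : ℝ)) * (1 - (v : ℝ)) * (if (h : ℕ) = 0 then (1 : ℝ) else 0)
    + (u : ℝ) * (1 - (v : ℝ)) * (if (h : ℕ) = (a : ℕ) then (1 : ℝ) else 0)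
    + (1 - (u : ℝ)) * (v : ℝ) * (if (h : ℕ) = (b : ℕ) then (1 : ℝ) else 0)
    + (u : ℝ) * (v : ℝ) * (if (h : ℕ) = (a : ℕ) + (b : ℕ) then (1 : ℝ) else 0)

namespace LawDec


/-- **DEC OF THE TWO-BLOB LAW WITH TWO LOWS AND A GIANT TOP, FROM AN EXPLICIT FLOW.**  Law `LAW2[p, u; q, v]` (atoms `0, p, q, p+q`),
floor `0 < x < 1`, gates `u, v ∈ [0,1]`, `1 ≤ p < q ≤ j″ < p + q` (the top is a GIANT at layer `j″`), target `T` with `2p < T ≤ 2q`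
(atoms `0` and `p` low, `q` a mid).  Flow: `p ↦ q` (amount `G`, `0 ≤ G ≤ u(1−v)`; when `G > 0`: `T < p + q`), `p ↦ p+q` (the rest of `u(1−v)`),
`0 ↦ q` (amount `F`, `0 ≤ F ≤ (1−u)(1−v)`; when `F > 0`: `T < q`), `0 ↦ p+q` (the rest).  If the mid is not overloaded —
`usage(p,q)·G + usage(0,q)·F ≤ (1−u)v` — and the giant is not overloaded — `(x/(1−x))·(u(1−v) − G + (1−u)(1−v) − F) ≤ uv` — then
`DECAtT x T j″ (p+q) LAW2[p, u; q, v]`. [this work] -/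
theorem twoBlob_decAtT_of_twoLowFlow_top (x u v T F G : ℝ) (p q j'' : ℕ) (hx0 : 0 < x) (hx1 : x < 1) (hp : 1 ≤ p) (hpq : p < q) (hqj : q ≤ j'') (hjs : j'' < p + q) (h2p : 2 * (p : ℝ) < T)
    (hTq : T ≤ 2 * (q : ℝ))
    (hG0 : 0 ≤ G) (hG1 : G ≤ u * (1 - v)) (hGq : 0 < G → T < (p : ℝ) + q)
    (hF0 : 0 ≤ F) (hF1 : F ≤ (1 - u) * (1 - v)) (hFq : 0 < F → T < (q : ℝ))
    (hmid : usage x T j'' p q * G + usage x T j'' 0 q * F ≤ (1 - u) * v)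
    (htop : x / (1 - x) * (u * (1 - v) - G + ((1 - u) * (1 - v) - F)) ≤ u * v) :
    DECAtT x T j'' (p + q) (fun h => LAW2[p, u, q, v, h]) := by
  classical
  have hT0 : 0 < T := by have : (0:ℝ) ≤ p := Nat.cast_nonneg p; linarith
  -- the flow
  set RG : ℝ := u * (1 - v) - G with hRG
  set RF : ℝ := (1 - u) * (1 - v) - F with hRF
  have hRG0 : 0 ≤ RG := by rw [hRG]; linarith
  have hRF0 : 0 ≤ RF := by rw [hRF]; linarith
  set f : ℕ → ℕ → ℝ := fun l h =>
    G * (if l = p then (1:ℝ) else 0) * (if h = q then (1:ℝ) else 0)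
      + RG * (if l = p then (1:ℝ) else 0) * (if h = p + q then (1:ℝ) else 0)
      + F * (if l = 0 then (1:ℝ) else 0) * (if h = q then (1:ℝ) else 0)
      + RF * (if l = 0 then (1:ℝ) else 0) * (if h = p + q then (1:ℝ) else 0) with hf
  have ind_nn : ∀ (P : Prop) [Decidable P], (0:ℝ) ≤ (if P then (1:ℝ) else 0) := fun P _ => by split_ifs <;> norm_num
  have hug : usage x T j'' p (p + q) = x / (1 - x) := usage_giant_eq x T j'' p (p + q) (by omega)
  have hu0g : usage x T j'' 0 (p + q) = x / (1 - x) := usage_giant_eq x T j'' 0 (p + q) (by omega)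
  refine decAtT_of_flowAtT x T j'' (p + q) _ hx0 hx1 (fun h hh => BlobDec2.law_eq_zero_of_lt p q u v h hh)
    (BlobDec2.law_mass p q u v) ⟨f, ?_, ?_, ?_, ?_⟩
  · -- nonnegativity
    intro l h
    simp only [hf]
    have i1 := ind_nn (l = p); have i2 := ind_nn (h = p + q); have i3 := ind_nn (l = 0); have i4 := ind_nn (h = q)
    have := mul_nonneg (mul_nonneg hG0 i1) i4
    have := mul_nonneg (mul_nonneg hRG0 i1) i2
    have := mul_nonneg (mul_nonneg hF0 i3) i4
    have := mul_nonneg (mul_nonneg hRF0 i3) i2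
    linarith
  · -- support: pairs (p,q) [G>0], (p,p+q), (0,q) [F>0], (0,p+q)
    intro l h hpos
    simp only [hf] at hpos
    by_cases hl : l = p
    · rw [if_pos hl, if_neg (show l ≠ 0 by omega)] at hpos
      simp only [mul_one, mul_zero, zero_mul, add_zero] at hpos
      by_cases hh : h = q
      · rw [if_pos hh, if_neg (show h ≠ p + q by omega), mul_one, mul_zero, add_zero] at hpos
        refine ⟨by omega, by rw [hl]; exact h2p, by omega, Or.inr ?_⟩
        rw [hl, hh]; exact hGq hpos
      · rw [if_neg hh, mul_zero, zero_add] at hpos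
        by_cases hh' : h = p + q
        · exact ⟨by omega, by rw [hl]; exact h2p, by omega, Or.inl (by omega)⟩
        · rw [if_neg hh', mul_zero] at hpos; exact absurd hpos (lt_irrefl 0)
    · rw [if_neg hl] at hpos
      by_cases hl0 : l = 0
      · rw [if_pos hl0] at hpos
        simp only [mul_one, mul_zero, zero_mul, zero_add] at hpos
        by_cases hh : h = q
        · rw [if_pos hh, if_neg (show h ≠ p + q by omega), mul_one, mul_zero, add_zero] at hpos
          refine ⟨by omega, by rw [hl0]; simpa using hT0, by omega, Or.inr ?_⟩
          rw [hl0, hh]; simpa using hFq hpos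
        · rw [if_neg hh, mul_zero, zero_add] at hpos
          by_cases hh' : h = p + q
          · exact ⟨by omega, by rw [hl0]; simpa using hT0, by omega, Or.inl (by omega)⟩
          · rw [if_neg hh', mul_zero] at hpos; exact absurd hpos (lt_irrefl 0)
      · rw [if_neg hl0] at hpos
        simp only [mul_zero, zero_mul, add_zero] at hpos
        exact absurd hpos (lt_irrefl 0)
  · -- every low atom is shipped exactly
    intro l hlj hlow
    have hsum : ∑ h ∈ Finset.range (p + q + 1), f l h
        = G * (if l = p then (1:ℝ) else 0) + RG * (if l = p then (1:ℝ) else 0)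
          + F * (if l = 0 then (1:ℝ) else 0) + RF * (if l = 0 then (1:ℝ) else 0) := by
      simp only [hf, Finset.sum_add_distrib]
      rw [BlobDec2.sum_range_const_indicator _ q (by omega), BlobDec2.sum_range_const_indicator _ (p + q) le_rfl,
        BlobDec2.sum_range_const_indicator _ q (by omega), BlobDec2.sum_range_const_indicator _ (p + q) le_rfl]
    rw [hsum]
    dsimp only
    have hlq : l ≠ q := by rintro rfl; linarith
    have hlpq : l ≠ p + q := by omega
    by_cases hl0 : l = 0
    · have hlp : l ≠ p := by omega
      rw [if_neg hlp, if_pos hl0, if_neg hlq, if_neg hlpq, hRF]; ring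
    · by_cases hl : l = p
      · rw [if_pos hl, if_neg hl0, if_neg hlq, if_neg hlpq, hRG]; ring
      · rw [if_neg hl, if_neg hl0, if_neg hlq, if_neg hlpq]; ring
  · -- no absorber is overloaded
    intro h hhM hself
    have hsum : ∑ l ∈ Finset.range (j'' + 1), usage x T j'' l h * f l h
        = usage x T j'' p h * G * (if h = q then (1:ℝ) else 0)
          + usage x T j'' p h * RG * (if h = p + q then (1:ℝ) else 0)
          + usage x T j'' 0 h * F * (if h = q then (1:ℝ) else 0)
          + usage x T j'' 0 h * RF * (if h = p + q then (1:ℝ) else 0) := by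
      have e : ∀ l, usage x T j'' l h * f l h
          = (usage x T j'' p h * G * (if h = q then (1:ℝ) else 0)) * (if l = p then (1:ℝ) else 0)
            + (usage x T j'' p h * RG * (if h = p + q then (1:ℝ) else 0)) * (if l = p then (1:ℝ) else 0)
            + (usage x T j'' 0 h * F * (if h = q then (1:ℝ) else 0)) * (if l = 0 then (1:ℝ) else 0)
            + (usage x T j'' 0 h * RF * (if h = p + q then (1:ℝ) else 0)) * (if l = 0 then (1:ℝ) else 0) := by
        intro l
        simp only [hf]
        by_cases hl : l = p
        · rw [if_pos hl, if_neg (show l ≠ 0 by omega), hl]; ring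
        · by_cases hl0 : l = 0
          · rw [if_neg hl, if_pos hl0, hl0]; ring
          · rw [if_neg hl, if_neg hl0]; ring
      simp only [e, Finset.sum_add_distrib]
      rw [BlobDec2.sum_range_const_indicator _ p (by omega), BlobDec2.sum_range_const_indicator _ p (by omega),
        BlobDec2.sum_range_const_indicator _ 0 (Nat.zero_le _), BlobDec2.sum_range_const_indicator _ 0 (Nat.zero_le _)]
    rw [hsum]
    dsimp only
    have hh0 : h ≠ 0 := by
      rintro rfl
      rcases hself with h1 | h1
      · omega
      · simp at h1; linarith
    have hhp : h ≠ p := by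
      rintro rfl
      rcases hself with h1 | h1
      · omega
      · linarith
    by_cases hq : h = q
    · have hpq' : h ≠ p + q := by omega
      rw [if_neg hpq', if_pos hq, if_neg hh0, if_neg hhp]
      simp only [mul_zero, zero_add, add_zero, mul_one]
      rw [hq]; linarith [hmid]
    · by_cases hpq' : h = p + q
      · rw [if_pos hpq', if_neg hq, if_neg hh0, if_neg hhp]
        simp only [mul_one, mul_zero, add_zero, zero_add]
        rw [hpq', hug, hu0g]
        have : x / (1 - x) * RG + x / (1 - x) * RF ≤ u * v := by rw [← mul_add]; exact htop
        linarith
      · rw [if_neg hpq', if_neg hq, if_neg hh0, if_neg hhp]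
        simp only [mul_zero, add_zero]
        rfl

end LawDec

end Quant

end Summit.CriticalPhenomena.PercolationContinuityZ3.Theorems
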